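import Literature.NumberTheory.NumberFields.IdealPowerOfUnramifiedRoot
import Literature.NumberTheory.NumberFields.SqrtGeneratorUnramified
import Literature.NumberTheory.NumberFields.CMFieldTotallyNegativeGenerator
import Mathlib.NumberTheory.NumberField.CMField
import Mathlib.NumberTheory.RamificationInertia.Galois
import HarnessLib

/-!
# A CM field unramified over its maximal real subfield at every finite prime is non-primary, and a non-primary
# CM field is unramified at the odd primes (Okazaki, *Acta Arith.* 92 (2000), Lemma 14, the two ramification clauses)

Topic `NumberTheory/NumberFields`; namespace `Literature.NumberTheory.NumberFields`.  Theorem-only file (no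
definition, no named fact, no `sorry`).  `K` is a CM number field with maximal real subfield
`K⁺ = maximalRealSubfield K` and complex conjugation `x ↦ x̄` (`complexConj K`, on `𝓞_K`:
`ringOfIntegersComplexConj K`).

> Okazaki, §3 **Definition 13.** "A CM-field `F` is said to be *non-primary* if `F = F⁺(√−δ)` for some `δ ∈ F⁺`
> which generates a square ideal of `F⁺`; it is said to be *primary* otherwise."  **Lemma 14** (last but one
> clause): "Moreover, `F` is non-primary if `F/F⁺` is unramified at the finite primes.  On the other hand, `F/F⁺`
> is unramified at all odd primes if `F` is non-primary."  (Proof: "This is well known (cf. [16] or [27, Theorems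
> 4.12 and 10.3])."; [16] = Lemmermeyer 1995, [27] = Washington.)

The reason: if `F = F⁺(α)`, `α² = −δ`, `δ ∈ 𝓞_{F⁺}`, then at a prime `𝔓 ∣ 𝔭` of `F` one has
`e(𝔓|𝔭) · v_𝔭(δ) = v_𝔓(α²) = 2 v_𝔓(α)` (Neukirch I (8.2)), so `v_𝔭(δ)` is even as soon as `e(𝔓|𝔭) = 1`; if this
holds at every `𝔭`, `(δ) = 𝔞²`.  We use the tree's `dvd_count_of_eq_pow_mul_of_ramificationIdx_eq_one` /
`dvd_count_of_eq_pow_of_isUnramifiedIn` and `exists_span_eq_pow_of_forall_count_dvd`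
(`IdealPowerOfUnramifiedRoot.lean`).  As in `CMFieldCapitulationKernelOddDegree.lean` §7 (Lemma 14), «`F = F⁺(√−δ)`,
`(δ) = 𝔞²`» is rendered by `α ∈ 𝓞_F`, `α ≠ 0`, `ᾱ = −α`, `δ ∈ 𝓞_{F⁺}` with `δ = −α²` in `𝓞_F`, and
`Ideal.span {δ} = 𝔞 ^ 2` (any such `α` generates `F` over `F⁺`).

## Main results (`K : Type` a CM number field)

* `IsCMField.exists_span_eq_sq_of_forall_ramificationIdxIn_eq_one` — if every finite prime of `K⁺` has
  ramification index `1` in `K` then, for EVERY `α ∈ 𝓞_K ∖ 0` and `δ ∈ 𝓞_{K⁺}` with `δ = −α²`, the ideal `(δ)` of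
  `𝓞_{K⁺}` is a square; `IsCMField.exists_span_eq_sq_of_isUnramifiedIn` — the same from Mathlib's
  `Algebra.IsUnramifiedIn (𝓞 K) 𝔭` at every `𝔭`.
* `IsCMField.exists_ringOfIntegers_complexConj_eq_neg` — there is `α ∈ 𝓞_K`, `α ≠ 0`, `ᾱ = −α`;
  `IsCMField.exists_algebraMap_eq_neg_sq` — and then `−α² ∈ 𝓞_{K⁺}`.
* **`IsCMField.nonPrimary_of_forall_ramificationIdxIn_eq_one`**, **`IsCMField.nonPrimary_of_isUnramifiedIn`** —
  Okazaki's first clause: `K/K⁺` unramified at all finite primes ⟹ `K` is non-primary, i.e. `K = K⁺(√−δ)` with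
  `δ ∈ 𝓞_{K⁺}`, `(δ) = 𝔞²` (in the form used by `IsCMField.lemma14_iff`).
* (§3) `IsCMField.forall_ramificationIdxIn_eq_one_iff_forall_isUnramifiedIn` — the two readings of «unramified at the
  finite primes» agree for `K/K⁺`; **`IsCMField.isUnramifiedIn_of_nonPrimary_of_two_notMem`** — Okazaki's second
  clause: a non-primary `K` is unramified over `K⁺` at every prime `𝔭 ∌ 2` (move the generator: `γ ∈ 𝔞⁻¹ ∖ 𝔞⁻¹𝔭`,
  `δ' = δγ²` with `(δ') = 𝔟²`, `𝔭 ∤ 𝔟`, `K = K⁺(αγ)`; then `4δ' ∉ 𝔭` and the different bound `𝔇 ∣ (2αγ)` of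
  `SqrtGeneratorUnramified.lean`).

Honest column: «unramified at the finite primes» is taken either as `e = 1` at every finite prime
(`Ideal.ramificationIdxIn`, the form in which it enters Chevalley's formula, `CMFieldAmbiguousClassNumber.lean`) or as
Mathlib's `Algebra.IsUnramifiedIn` (equivalent, §3); «odd prime» is `2 ∉ 𝔭`; the primes above `2` are not treated
(there the clause says nothing).

## References

* R. Okazaki, *Inclusion of CM-fields and divisibility of relative class numbers*, Acta Arith. 92 (2000)
  319–338, §3 Definition 13 and Lemma 14 (held `paper:doi-10-4064-aa-92-4-319-338`, p. 8). [Okazaki2000]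
* J. Neukirch, *Algebraic Number Theory* (1999), Ch. I §8 Prop. (8.2); Ch. III §2 (2.6) (the different and
  ramification). [NeukirchANT1999]
* L. C. Washington, *Introduction to Cyclotomic Fields*, 2nd ed. (1997), Thm. 10.3. [Washington1997]
-/

noncomputable section

open NumberField NumberField.IsCMField IsDedekindDomain
open scoped nonZeroDivisors

namespace Literature.NumberTheory.NumberFields

variable (K : Type) [Field K] [NumberField K] [IsCMField K]

/-! ### §1. `e = 1` everywhere ⟹ `(δ)` is a square for every presentation `K = K⁺(√−δ)`, `δ ∈ 𝓞_{K⁺}` -/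

/-- **If every finite prime of `K⁺` has ramification index `1` in the CM field `K`, then `(δ) = 𝔞²` for every
`δ ∈ 𝓞_{K⁺}` of the form `δ = −α²`, `α ∈ 𝓞_K ∖ 0`** (`e(𝔓|𝔭) v_𝔭(δ) = 2 v_𝔓(α)` at a prime `𝔓 ∣ 𝔭`).
[cite: Okazaki2000, §3 Lemma 14 («F is non-primary if F/F⁺ is unramified at the finite primes»)]
[cite: NeukirchANT1999, Ch. I §8 Prop. (8.2)] -/
theorem IsCMField.exists_span_eq_sq_of_forall_ramificationIdxIn_eq_one
    (h1 : ∀ v : HeightOneSpectrum (𝓞 (maximalRealSubfield K)), v.asIdeal.ramificationIdxIn (𝓞 K) = 1)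
    {α : 𝓞 K} {δ : 𝓞 (maximalRealSubfield K)} (hα : α ≠ 0)
    (hδ : algebraMap (𝓞 (maximalRealSubfield K)) (𝓞 K) δ = -(α ^ 2)) :
    ∃ 𝔞 : Ideal (𝓞 (maximalRealSubfield K)), Ideal.span {δ} = 𝔞 ^ 2 := by
  have hδ' : algebraMap (𝓞 (maximalRealSubfield K)) (𝓞 K) (-δ) = α ^ 2 := by rw [map_neg, hδ, neg_neg]
  have hδ0 : -δ ≠ 0 := by
    intro h0
    rw [h0, map_zero] at hδ'
    exact hα ((pow_eq_zero_iff two_ne_zero).mp hδ'.symm)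
  obtain ⟨𝔞, h𝔞⟩ := exists_span_eq_pow_of_forall_count_dvd hδ0 (n := 2) fun v => by
    haveI := v.isMaximal
    obtain ⟨Q, hQmax, hQover⟩ :=
      Ideal.exists_maximal_ideal_liesOver_of_isIntegral (S := 𝓞 K) v.asIdeal
    haveI := hQmax
    haveI := hQover
    have hQ0 : Q ≠ ⊥ := Ideal.ne_bot_of_liesOver_of_ne_bot v.ne_bot Q
    set w : HeightOneSpectrum (𝓞 K) := ⟨Q, hQmax.isPrime, hQ0⟩ with hw
    haveI : w.asIdeal.LiesOver v.asIdeal := hQover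
    have he : v.asIdeal.ramificationIdx' w.asIdeal = 1 := by
      rw [Ideal.ramificationIdx'_eq_ramificationIdx v.asIdeal w.asIdeal v.ne_bot,
        ← Ideal.ramificationIdxIn_eq_ramificationIdx v.asIdeal w.asIdeal (K ≃ₐ[maximalRealSubfield K] K)]
      exact h1 v
    exact dvd_count_of_eq_pow_mul_of_ramificationIdx_eq_one hδ0 (u := 1) (by rw [hδ', mul_one]) v w he
      fun hmem => hQmax.ne_top ((Ideal.eq_top_iff_one _).mpr hmem)
  exact ⟨𝔞, by rw [← Ideal.span_singleton_neg, h𝔞]⟩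

omit [IsCMField K] in
/-- The same from Mathlib's «`K/K⁺` is unramified at every finite prime» (`Algebra.IsUnramifiedIn (𝓞 K) 𝔭` for all
`𝔭`; this direction does not use that `K` is CM). [cite: Okazaki2000, §3 Lemma 14] [cite: NeukirchANT1999, Ch. I §8 Prop. (8.2)] -/
theorem IsCMField.exists_span_eq_sq_of_isUnramifiedIn
    (hunr : ∀ v : HeightOneSpectrum (𝓞 (maximalRealSubfield K)), Algebra.IsUnramifiedIn (𝓞 K) v.asIdeal)
    {α : 𝓞 K} {δ : 𝓞 (maximalRealSubfield K)} (hα : α ≠ 0)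
    (hδ : algebraMap (𝓞 (maximalRealSubfield K)) (𝓞 K) δ = -(α ^ 2)) :
    ∃ 𝔞 : Ideal (𝓞 (maximalRealSubfield K)), Ideal.span {δ} = 𝔞 ^ 2 := by
  have hδ' : algebraMap (𝓞 (maximalRealSubfield K)) (𝓞 K) (-δ) = α ^ 2 := by rw [map_neg, hδ, neg_neg]
  have hδ0 : -δ ≠ 0 := by
    intro h0
    rw [h0, map_zero] at hδ'
    exact hα ((pow_eq_zero_iff two_ne_zero).mp hδ'.symm)
  obtain ⟨𝔞, h𝔞⟩ := exists_span_eq_pow_of_forall_count_dvd hδ0 (n := 2) fun v =>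
    dvd_count_of_eq_pow_of_isUnramifiedIn hδ0 hδ' v (hunr v)
  exact ⟨𝔞, by rw [← Ideal.span_singleton_neg, h𝔞]⟩

/-! ### §2. A purely imaginary algebraic integer, and Okazaki's clause -/

/-- There is `α ∈ 𝓞_K`, `α ≠ 0`, with `ᾱ = −α` (take `x − x̄` for an algebraic integer `x ∉ K⁺`).
[cite: Okazaki2000, §3 Definition 13 («F = F⁺(√−δ)»)] -/
theorem IsCMField.exists_ringOfIntegers_complexConj_eq_neg :
    ∃ α : 𝓞 K, α ≠ 0 ∧ ringOfIntegersComplexConj K α = -α := by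
  -- some algebraic integer is moved by complex conjugation
  have hex : ∃ x : 𝓞 K, ringOfIntegersComplexConj K x ≠ x := by
    by_contra hall
    push Not at hall
    obtain ⟨z, hz⟩ := IsCMField.exists_complexConj_ne K
    obtain ⟨a, b, -, rfl⟩ := IsFractionRing.div_surjective (A := 𝓞 K) z
    apply hz
    have ha : complexConj K (a : K) = a := by
      have := congrArg (fun y : 𝓞 K => (y : K)) (hall a)
      rwa [coe_ringOfIntegersComplexConj] at this
    have hb : complexConj K (b : K) = b := by
      have := congrArg (fun y : 𝓞 K => (y : K)) (hall b)
      rwa [coe_ringOfIntegersComplexConj] at this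
    change complexConj K ((a : K) / (b : K)) = (a : K) / (b : K)
    rw [map_div₀, ha, hb]
  obtain ⟨x, hx⟩ := hex
  refine ⟨x - ringOfIntegersComplexConj K x, ?_, ?_⟩
  · intro h0
    exact hx (sub_eq_zero.mp h0).symm
  · have hcc : ringOfIntegersComplexConj K (ringOfIntegersComplexConj K x) = x :=
      RingOfIntegers.ext (by rw [coe_ringOfIntegersComplexConj, coe_ringOfIntegersComplexConj,
        complexConj_apply_apply])
    rw [map_sub, hcc, neg_sub]

/-- For `ᾱ = −α` the square `α²` lies in `𝓞_{K⁺}`: there is `δ ∈ 𝓞_{K⁺}` with `δ = −α²` in `𝓞_K`.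
[cite: Okazaki2000, §3 Definition 13] -/
theorem IsCMField.exists_algebraMap_eq_neg_sq {α : 𝓞 K} (hα : ringOfIntegersComplexConj K α = -α) :
    ∃ δ : 𝓞 (maximalRealSubfield K), algebraMap (𝓞 (maximalRealSubfield K)) (𝓞 K) δ = -(α ^ 2) := by
  have hfix : ringOfIntegersComplexConj K (α ^ 2) = α ^ 2 := by rw [map_pow, hα, neg_sq]
  obtain ⟨y, hy⟩ := (ringOfIntegersComplexConj_eq_self_iff K (α ^ 2)).mp hfix
  exact ⟨-y, by rw [map_neg, hy]⟩

/-- **Okazaki's Lemma 14, ramification clause: a CM field `K` such that every finite prime of `K⁺` has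
ramification index `1` in `K` is non-primary** — `K = K⁺(√−δ)` with `δ ∈ 𝓞_{K⁺}` generating a square ideal:
there are `α ∈ 𝓞_K ∖ 0` with `ᾱ = −α`, `δ ∈ 𝓞_{K⁺}` with `δ = −α²`, and an ideal `𝔞` with `(δ) = 𝔞²`.
[cite: Okazaki2000, §3 Lemma 14 («F is non-primary if F/F⁺ is unramified at the finite primes»)] -/
theorem IsCMField.nonPrimary_of_forall_ramificationIdxIn_eq_one
    (h1 : ∀ v : HeightOneSpectrum (𝓞 (maximalRealSubfield K)), v.asIdeal.ramificationIdxIn (𝓞 K) = 1) :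
    ∃ (α : 𝓞 K) (δ : 𝓞 (maximalRealSubfield K)) (𝔞 : Ideal (𝓞 (maximalRealSubfield K))),
      α ≠ 0 ∧ ringOfIntegersComplexConj K α = -α ∧
        algebraMap (𝓞 (maximalRealSubfield K)) (𝓞 K) δ = -(α ^ 2) ∧ Ideal.span {δ} = 𝔞 ^ 2 := by
  obtain ⟨α, hα0, hα⟩ := IsCMField.exists_ringOfIntegers_complexConj_eq_neg K
  obtain ⟨δ, hδ⟩ := IsCMField.exists_algebraMap_eq_neg_sq K hα
  obtain ⟨𝔞, h𝔞⟩ := IsCMField.exists_span_eq_sq_of_forall_ramificationIdxIn_eq_one K h1 hα0 hδ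
  exact ⟨α, δ, 𝔞, hα0, hα, hδ, h𝔞⟩

/-- **The same with Mathlib's unramifiedness: `K/K⁺` unramified at every finite prime ⟹ `K` non-primary.**
[cite: Okazaki2000, §3 Lemma 14] -/
theorem IsCMField.nonPrimary_of_isUnramifiedIn
    (hunr : ∀ v : HeightOneSpectrum (𝓞 (maximalRealSubfield K)), Algebra.IsUnramifiedIn (𝓞 K) v.asIdeal) :
    ∃ (α : 𝓞 K) (δ : 𝓞 (maximalRealSubfield K)) (𝔞 : Ideal (𝓞 (maximalRealSubfield K))),
      α ≠ 0 ∧ ringOfIntegersComplexConj K α = -α ∧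
        algebraMap (𝓞 (maximalRealSubfield K)) (𝓞 K) δ = -(α ^ 2) ∧ Ideal.span {δ} = 𝔞 ^ 2 := by
  obtain ⟨α, hα0, hα⟩ := IsCMField.exists_ringOfIntegers_complexConj_eq_neg K
  obtain ⟨δ, hδ⟩ := IsCMField.exists_algebraMap_eq_neg_sq K hα
  obtain ⟨𝔞, h𝔞⟩ := IsCMField.exists_span_eq_sq_of_isUnramifiedIn K hunr hα0 hδ
  exact ⟨α, δ, 𝔞, hα0, hα, hδ, h𝔞⟩

/-! ### §3. `e = 1` everywhere versus Mathlib's unramifiedness; non-primary ⟹ unramified at the odd primes -/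

omit [IsCMField K] in
/-- For the Galois extension `K/K⁺`: every finite prime of `K⁺` has ramification index `1` in `K` iff `K/K⁺` is
unramified at every finite prime in Mathlib's sense (`Algebra.IsUnramifiedIn`; residue fields are finite, hence
perfect). [cite: NeukirchANT1999, Ch. I §8 Prop. (8.2) and §9 Prop. (9.1)] -/
theorem IsCMField.forall_ramificationIdxIn_eq_one_iff_forall_isUnramifiedIn [IsGalois (maximalRealSubfield K) K] :
    (∀ v : HeightOneSpectrum (𝓞 (maximalRealSubfield K)), v.asIdeal.ramificationIdxIn (𝓞 K) = 1) ↔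
      ∀ v : HeightOneSpectrum (𝓞 (maximalRealSubfield K)), Algebra.IsUnramifiedIn (𝓞 K) v.asIdeal := by
  refine forall_congr' fun v => ?_
  rw [Algebra.isUnramifiedIn_iff_forall_ramificationIdx_eq_one]
  constructor
  · intro h1 Q _ hQover
    haveI := hQover
    rw [← Ideal.ramificationIdxIn_eq_ramificationIdx v.asIdeal Q (K ≃ₐ[maximalRealSubfield K] K)]
    exact h1
  · intro h
    haveI := v.isMaximal
    obtain ⟨Q, hQmax, hQover⟩ :=
      Ideal.exists_maximal_ideal_liesOver_of_isIntegral (S := 𝓞 K) v.asIdeal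
    haveI := hQmax
    haveI := hQover
    rw [Ideal.ramificationIdxIn_eq_ramificationIdx v.asIdeal Q (K ≃ₐ[maximalRealSubfield K] K)]
    exact h Q hQover

/-- `K⁺[a] = K` as a `K⁺`-subalgebra for any `a ∈ K` moved by complex conjugation (`[K : K⁺] = 2`; the tree's
`IsCMField.adjoin_simple_eq_top_of_complexConj_ne`, re-proved to keep the imports light). [folklore] -/
private theorem adjoin_eq_top_of_complexConj_ne' {a : K} (ha : complexConj K a ≠ a) :
    Algebra.adjoin (maximalRealSubfield K) {a} = ⊤ := by
  set E := IntermediateField.adjoin (maximalRealSubfield K) {a} with hE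
  have hne : E ≠ ⊥ := by
    intro h
    have hmem : a ∈ E := IntermediateField.mem_adjoin_simple_self (maximalRealSubfield K) a
    rw [h, IntermediateField.mem_bot] at hmem
    obtain ⟨y, hy⟩ := hmem
    apply ha
    rw [← hy]
    exact complexConj_apply_eq_self K y
  have h2 : Module.finrank (maximalRealSubfield K) K = 2 :=
    Algebra.IsQuadraticExtension.finrank_eq_two (maximalRealSubfield K) K
  have hdvd : Module.finrank (maximalRealSubfield K) E ∣ 2 := by
    rw [← h2, ← Module.finrank_mul_finrank (maximalRealSubfield K) E K]
    exact Dvd.intro _ rfl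
  have hne1 : Module.finrank (maximalRealSubfield K) E ≠ 1 := by
    rw [Ne, IntermediateField.finrank_eq_one_iff]; exact hne
  have hE2 : Module.finrank (maximalRealSubfield K) E = 2 := by
    rcases (Nat.dvd_prime Nat.prime_two).mp hdvd with h | h
    · exact absurd h hne1
    · exact h
  have htop : E = ⊤ := by
    apply IntermediateField.eq_of_le_of_finrank_eq le_top
    rw [hE2, IntermediateField.finrank_top', h2]
  rw [← IntermediateField.adjoin_simple_toSubalgebra_of_isAlgebraic (Algebra.IsAlgebraic.isAlgebraic a), ← hE, htop,
    IntermediateField.top_toSubalgebra]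

/-- **Okazaki's Lemma 14, last clause: a non-primary CM field `K` is unramified over `K⁺` at all odd primes.**  If
`K = K⁺(α)`, `ᾱ = −α ≠ 0`, `α² = −δ` with `δ ∈ 𝓞_{K⁺}` and `(δ) = 𝔞²`, then every prime `𝔭 ∤ 2` of `K⁺` is unramified
in `K` («`F/F⁺` is unramified at all odd primes if `F` is non-primary»).  Proof: pick `γ ∈ 𝔞⁻¹ ∖ 𝔞⁻¹𝔭`; then
`δ' = δγ² ∈ 𝓞_{K⁺}` with `(δ') = 𝔟²`, `𝔭 ∤ 𝔟`, and `K = K⁺(αγ)`, `(αγ)² = −δ'`, `4δ' ∉ 𝔭` — so no prime above `𝔭`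
divides the different (tree `isUnramifiedAt_of_sq_eq`, Neukirch III (2.6)). [cite: Okazaki2000, §3 Lemma 14 («F/F⁺ is
unramified at all odd primes if F is non-primary»)] [cite: NeukirchANT1999, Ch. III §2 (2.6)] -/
theorem IsCMField.isUnramifiedIn_of_nonPrimary_of_two_notMem {α : 𝓞 K} {δ : 𝓞 (maximalRealSubfield K)}
    {𝔞 : Ideal (𝓞 (maximalRealSubfield K))} (hα0 : α ≠ 0) (hα : ringOfIntegersComplexConj K α = -α)
    (hδ : algebraMap (𝓞 (maximalRealSubfield K)) (𝓞 K) δ = -(α ^ 2)) (h𝔞 : Ideal.span {δ} = 𝔞 ^ 2)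
    (v : HeightOneSpectrum (𝓞 (maximalRealSubfield K))) (hv : (2 : 𝓞 (maximalRealSubfield K)) ∉ v.asIdeal) :
    Algebra.IsUnramifiedIn (𝓞 K) v.asIdeal := by
  classical
  have hδ0 : δ ≠ 0 := by
    intro h0
    rw [h0, map_zero, eq_comm, neg_eq_zero] at hδ
    exact hα0 ((pow_eq_zero_iff two_ne_zero).mp hδ)
  have h𝔞0 : 𝔞 ≠ ⊥ := by
    intro h
    rw [h, ← Ideal.zero_eq_bot, zero_pow two_ne_zero, Ideal.zero_eq_bot, Ideal.span_singleton_eq_bot] at h𝔞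
    exact hδ0 h𝔞
  -- the fractional ideals `A = 𝔞`, `P = 𝔭` of `K⁺`
  set A : FractionalIdeal (𝓞 (maximalRealSubfield K))⁰ (maximalRealSubfield K) :=
    ((𝔞 : Ideal (𝓞 (maximalRealSubfield K))) : FractionalIdeal (𝓞 (maximalRealSubfield K))⁰ (maximalRealSubfield K))
    with hA
  set P : FractionalIdeal (𝓞 (maximalRealSubfield K))⁰ (maximalRealSubfield K) :=
    ((v.asIdeal : Ideal (𝓞 (maximalRealSubfield K))) :
      FractionalIdeal (𝓞 (maximalRealSubfield K))⁰ (maximalRealSubfield K)) with hP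
  have hA0 : A ≠ 0 := FractionalIdeal.coeIdeal_ne_zero.mpr h𝔞0
  have hP1 : P ≠ 1 := by
    rw [hP, Ne, FractionalIdeal.coeIdeal_eq_one, Ideal.one_eq_top]
    exact v.isPrime.ne_top
  -- `γ ∈ 𝔞⁻¹ ∖ 𝔞⁻¹𝔭`
  have hlt : A⁻¹ * P < A⁻¹ := by
    refine lt_of_le_of_ne ?_ fun h => hP1 ?_
    · calc A⁻¹ * P ≤ A⁻¹ * 1 := mul_le_mul_right FractionalIdeal.coeIdeal_le_one _
        _ = A⁻¹ := mul_one _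
    · exact mul_left_cancel₀ (inv_ne_zero hA0) (h.trans (mul_one _).symm)
  obtain ⟨γ, hγA, hγP⟩ := SetLike.exists_of_lt hlt
  -- `(γ)𝔞 = 𝔟` is integral and `𝔭 ∤ 𝔟`
  have hsA : FractionalIdeal.spanSingleton (𝓞 (maximalRealSubfield K))⁰ γ * A ≤ 1 := by
    calc FractionalIdeal.spanSingleton _ γ * A ≤ A⁻¹ * A :=
          mul_le_mul_left (FractionalIdeal.spanSingleton_le_iff_mem.mpr hγA) _
      _ = 1 := inv_mul_cancel₀ hA0
  obtain ⟨𝔟, h𝔟⟩ := FractionalIdeal.le_one_iff_exists_coeIdeal.mp hsA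
  have h𝔟P : ¬ 𝔟 ≤ v.asIdeal := by
    intro hle
    apply hγP
    have h1 : FractionalIdeal.spanSingleton (𝓞 (maximalRealSubfield K))⁰ γ * A ≤ P := by
      rw [← h𝔟, hP, FractionalIdeal.coeIdeal_le_coeIdeal]; exact hle
    have h2 : FractionalIdeal.spanSingleton (𝓞 (maximalRealSubfield K))⁰ γ ≤ A⁻¹ * P := by
      calc FractionalIdeal.spanSingleton _ γ
            = FractionalIdeal.spanSingleton _ γ * A * A⁻¹ := by rw [mul_assoc, mul_inv_cancel₀ hA0, mul_one]
        _ ≤ P * A⁻¹ := mul_le_mul_left h1 _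
        _ = A⁻¹ * P := mul_comm _ _
    exact FractionalIdeal.spanSingleton_le_iff_mem.mp h2
  -- `δ' = δ γ²` is integral with `(δ') = 𝔟²`
  set δ' : maximalRealSubfield K :=
    algebraMap (𝓞 (maximalRealSubfield K)) (maximalRealSubfield K) δ * γ ^ 2 with hδ'
  have hspan : FractionalIdeal.spanSingleton (𝓞 (maximalRealSubfield K))⁰ δ' =
      ((𝔟 ^ 2 : Ideal (𝓞 (maximalRealSubfield K))) :
        FractionalIdeal (𝓞 (maximalRealSubfield K))⁰ (maximalRealSubfield K)) := by
    rw [FractionalIdeal.coeIdeal_pow, h𝔟, mul_pow, hA, ← FractionalIdeal.coeIdeal_pow, ← h𝔞,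
      FractionalIdeal.coeIdeal_span_singleton, FractionalIdeal.spanSingleton_pow,
      FractionalIdeal.spanSingleton_mul_spanSingleton, hδ', mul_comm]
  obtain ⟨d, hd⟩ : ∃ d : 𝓞 (maximalRealSubfield K), algebraMap _ (maximalRealSubfield K) d = δ' := by
    have h1 : FractionalIdeal.spanSingleton (𝓞 (maximalRealSubfield K))⁰ δ' ≤ 1 := by
      rw [hspan]; exact FractionalIdeal.coeIdeal_le_one
    exact (FractionalIdeal.mem_one_iff _).mp (FractionalIdeal.spanSingleton_le_iff_mem.mp h1)
  have hdP : d ∉ v.asIdeal := by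
    intro hmem
    apply h𝔟P
    have h1 : (𝔟 ^ 2 : Ideal (𝓞 (maximalRealSubfield K))) ≤ v.asIdeal := by
      rw [← FractionalIdeal.coeIdeal_le_coeIdeal (maximalRealSubfield K), ← hspan, ← hd,
        ← FractionalIdeal.coeIdeal_span_singleton, FractionalIdeal.coeIdeal_le_coeIdeal,
        Ideal.span_singleton_le_iff_mem]
      exact hmem
    exact (Ideal.IsPrime.pow_le_iff two_ne_zero).mp h1
  -- the new generator `x = α γ ∈ 𝓞_K`, `x² = −δ'`
  have hcoe : ∀ z : 𝓞 (maximalRealSubfield K),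
      ((algebraMap (𝓞 (maximalRealSubfield K)) (𝓞 K) z : 𝓞 K) : K) =
        ((algebraMap (𝓞 (maximalRealSubfield K)) (maximalRealSubfield K) z : maximalRealSubfield K) : K) :=
    fun z => by
      change algebraMap (𝓞 K) K (algebraMap (𝓞 (maximalRealSubfield K)) (𝓞 K) z) =
        algebraMap (maximalRealSubfield K) K
          (algebraMap (𝓞 (maximalRealSubfield K)) (maximalRealSubfield K) z)
      rw [← IsScalarTower.algebraMap_apply, ← IsScalarTower.algebraMap_apply]
  have hδK : ((algebraMap (𝓞 (maximalRealSubfield K)) (maximalRealSubfield K) δ : maximalRealSubfield K) : K) =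
      -((α : K)) ^ 2 := by
    rw [← hcoe δ, hδ]
    simp only [RingOfIntegers.coe_eq_algebraMap, map_neg, map_pow]
  have hα2 : ((α : K)) ^ 2 =
      -((algebraMap (𝓞 (maximalRealSubfield K)) (maximalRealSubfield K) δ : maximalRealSubfield K) : K) := by
    rw [hδK, neg_neg]
  have hαK : complexConj K (α : K) = -(α : K) := by
    have h := congrArg (fun y : 𝓞 K => (y : K)) hα
    rw [coe_ringOfIntegersComplexConj] at h
    simp only [RingOfIntegers.coe_eq_algebraMap, map_neg] at h
    exact h
  have hγ0 : γ ≠ 0 := by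
    rintro rfl
    exact hγP (FractionalIdeal.mem_coe.mp (Submodule.zero_mem _))
  set x' : K := (α : K) * ((γ : maximalRealSubfield K) : K) with hx'
  have hx'sq : x' ^ 2 = ((algebraMap (𝓞 (maximalRealSubfield K)) (𝓞 K) (-d) : 𝓞 K) : K) := by
    rw [hcoe, map_neg, hd, hx', mul_pow, hα2, hδ']
    push_cast
    ring
  have hx'int : IsIntegral ℤ x' :=
    IsIntegral.of_pow two_pos (by rw [hx'sq]; exact RingOfIntegers.isIntegral_coe _)
  set x : 𝓞 K := ⟨x', hx'int⟩ with hxdef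
  have hx : x ^ 2 = algebraMap (𝓞 (maximalRealSubfield K)) (𝓞 K) (-d) := by
    apply RingOfIntegers.ext
    change algebraMap (𝓞 K) K (x ^ 2) = _
    rw [map_pow]
    exact hx'sq
  have hx'0 : x' ≠ 0 := by
    refine mul_ne_zero (RingOfIntegers.coe_ne_zero_iff.mpr hα0) ?_
    change algebraMap (maximalRealSubfield K) K γ ≠ 0
    exact (map_ne_zero _).mpr hγ0
  have hconj : complexConj K (x : K) ≠ (x : K) := by
    change complexConj K x' ≠ x'
    rw [hx', map_mul, hαK, complexConj_apply_eq_self, neg_mul]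
    intro h
    have h2 : (2 : K) * ((α : K) * ((γ : maximalRealSubfield K) : K)) = 0 := by linear_combination -h
    exact hx'0 ((mul_eq_zero.mp h2).resolve_left two_ne_zero)
  have hgen : Algebra.adjoin (maximalRealSubfield K) {(x : K)} = ⊤ := adjoin_eq_top_of_complexConj_ne' K hconj
  -- every prime above `𝔭` is unramified
  intro Q hQ hover
  refine isUnramifiedAt_of_sq_eq hx hgen Q fun hmem => ?_
  have hmem' : (4 * -d : 𝓞 (maximalRealSubfield K)) ∈ v.asIdeal := by
    rw [hover.over, Ideal.under_def, Ideal.mem_comap]; exact hmem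
  rcases v.isPrime.mem_or_mem hmem' with h4 | hd'
  · have h22 : (4 : 𝓞 (maximalRealSubfield K)) = 2 * 2 := by norm_num
    rw [h22] at h4
    rcases v.isPrime.mem_or_mem h4 with h | h <;> exact hv h
  · exact hdP ((Ideal.neg_mem_iff _).mp hd')

end Literature.NumberTheory.NumberFields

end
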